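import Summits.HodgeConjecture.HodgeConjecture.Theorems.WeilTypeLadderOnPath
import Literature.AlgebraicGeometry.HodgeTheory.FermatHodgeConjecture
import Literature.AlgebraicGeometry.HodgeTheory.AlgebraicClassesPullback
import Literature.AlgebraicGeometry.HodgeTheory.SurjectivePullbackAlgebraicClasses
import HarnessLib

/-!
# WeilTypeLadder · the FERMAT TRANSFER: Weil classes dominated by a Fermat variety are algebraic
# (Shioda 1979 + Fulton Cor. 19.2 (b) + the degree trick), and the case lines it opens under R1′ / R∞ / R2₈

b2b cell `hweil` (packet `run/shared/lean/b2b/hodge-weil/`, report `b2b-hweil-pv3-g37/FERMAT-TRANSFER.md`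
THEOREM F and `b2b-hweil-pv3-g38/KERNEL-TRANSFER.md`). KERNEL FORM of the transfer step of THEOREM F:

* `mem_algebraicClasses_of_fermatTransfer` — **the Fermat transfer principle** (PROVED here from two
  REFEREED named facts and the tree's proved degree trick). Let `X = Xᵏₘ` be a smooth projective Fermat
  variety with `m` prime or `1 < m ≤ 20`, `Z` smooth projective of dimension `z`, `T` smooth projective of
  the SAME dimension `z`, `a : T ⟶ Z` SURJECTIVE and `b : T ⟶ X` any morphism. If a class
  `c ∈ H²ᵖ(Z(ℂ); ℂ)` satisfies `a^* c = b^* c'` for some `c'` in the `ℂ`-span of the rational `(p,p)`-classes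
  of `X`, then `c` is algebraic: `c'` is algebraic (Shioda 1979, the named fact
  `hodgeClasses_algebraic_fermat`), so is `b^* c'` (Fulton 1998 Cor. 19.2 (b), the named fact
  `fulton1998_map_mem_algebraicClasses`), i.e. `a^* c`, hence `c` (degree trick `a_* a^* = deg a • id`,
  `mem_algebraicClasses_of_map_mem_of_surjective`, PROVED in `HodgeTheory/SurjectivePullbackAlgebraicClasses`).
* `weilClassesImaginaryQuadratic_fermatTransfer_of_facts` / `_of_weilClassesImaginaryQuadratic` /
  `_of_hodgeConjecture` — the R∞-shaped body (`WeilClassesImaginaryQuadratic`, every `n ≥ 2`, every `d`) on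
  the locus of Weil-type abelian `2n`-folds `(A, φ)` carrying a FERMAT TRANSFER DATUM `(X, T, a, b)` as above
  (`dim T = 2n`), for the classes of the Weil plane with a partner `c'`: from the two facts; from the rung;
  from `HodgeConjecture` (on-path).
* `nonsplitSixfolds_fermatSexticTransfer_of_facts` / `_of_nonsplitSixfolds` / `_of_hodgeConjecture` — the
  literal R1′-shaped body (`NonsplitSixfolds` at `d = 3`, Fermat SEXTIC SIXFOLD `X⁶₆`, the rung's
  non-hyperbolicity binder carried and not used): **case line CL4-candidate** "Fermat-sextic-dominated
  ℚ(√-3)-Weil sixfolds".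
* `splitEightfolds_fermatSexticTransfer_of_facts` / `_of_splitEightfolds` / `_of_hodgeConjecture` — the
  literal R2₈-shaped body at `d = 3` with the Fermat sextic EIGHTFOLD `X⁸₆`.

WHICH ABELIAN VARIETIES CARRY SUCH A DATUM is NOT decided in the kernel. The packet's THEOREM F (pen-and-paper,
certified at reading level by referee-g147 R820 (b)) constructs one for the ζ₆-primitive Prym `B` of EVERY
Weil-type `ℤ/6`-cover `C → ℙ¹` with `N` branch points (`h = N - 2 = dim B`): KEY LEMMA `Cʰ/G ≅ Xʰ₆/ker β`
(both are the normalization of `ℙʰ` in one Kummer extension), `T` = a resolution of the dominant component of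
`Cʰ ×_{Cʰ/G} Xʰ₆`, `a = (Abel–Prym sum) ∘ pr_{Cʰ}`, `b = pr_X`, and `a^*(U' ⊗ ℂ) = b^*(M ⊗ ℂ)` with `U'` the
Weil plane of `B` and `M ⊂ Hʰ(Xʰ₆, ℚ)` the sum of the eigenspaces `V_{nβ}`, `n ∈ (ℤ/6)ˣ`, which consists of
rational `(h/2,h/2)`-classes exactly when `β` is of Weil type. For `N = 8` these are the 31 five-parameter
families of `(3,3)` ℚ(√-3)-sixfolds of the census `Theorems/WeilTypeLadderCyclicSexticTuples` (13 simple =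
Schoen's, 6 non-simple split, 12 non-simple NON-SPLIT = CENSUS C15); for `N = 10` the 53 families of `(4,4)`
eightfolds (22 non-split). None of that geometry (normalization, function fields, fibre products,
resolution) is on the tree's carriers; it is NOT restated here as a named fact (house rule: THEOREM F is not a
published statement). HONEST LABEL: sub-families, not the general member of any component; 0 unconditional
rungs above the floor are added; conditional on [Shioda 1979] and [Fulton 1998, Cor. 19.2 (b)] (both
refereed) only; Markman-free. No `sorry`, no new definition, no new named fact.
-/

noncomputable section

-- every declaration of this problem lives in `Summit.HodgeConjecture.HodgeConjecture.…` (summit = sub-problem)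
set_option linter.dupNamespace false

open CategoryTheory
open Literature.AlgebraicGeometry Literature.AlgebraicGeometry.Motives
open Literature.AlgebraicGeometry.HodgeTheory
open Literature.AlgebraicTopology.SingularHomology

namespace Summit.HodgeConjecture.HodgeConjecture.WeilTypeLadder

/-! ### §1 The Fermat transfer principle (proved from the two named facts) -/

section Principle

variable {k m z p : ℕ} {X T Z : Motives.SchemeOver ℂ}

/-- **The Fermat transfer principle.** `X` a smooth projective Fermat variety `Xᵏₘ` with `m` prime or
`1 < m ≤ 20`; `Z`, `T` smooth projective of the same dimension `z`; `a : T ⟶ Z` surjective, `b : T ⟶ X`.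
If `a^* c = b^* c'` with `c'` in the `ℂ`-span of the rational `(p,p)`-classes of `X`, then `c ∈ Nᵖ H²ᵖ(Z(ℂ))`:
Shioda (`c'` algebraic) + Fulton Cor. 19.2 (b) (`b^* c'` algebraic) + the degree trick along `a`.
Conditional on the two named facts only. [cite: Shioda1979PJA, §2 Thm. 1 and the list after it (p. 112)]
[cite: Fulton1998, §19.2 Cor. 19.2 (b)] [cite: VoisinHodgeI2002, §7.3.2 Remark 7.29] -/
theorem mem_algebraicClasses_of_fermatTransfer
    (hF : hodgeClasses_algebraic_fermat) (hP : fulton1998_map_mem_algebraicClasses)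
    (hm : m.Prime ∨ (1 < m ∧ m ≤ 20)) (hXF : IsFermatVariety k m X) (hX : IsSmoothProjective k X)
    (hZ : IsSmoothProjective z Z) (hT : IsSmoothProjective z T)
    (a : T ⟶ Z) [AlgebraicGeometry.Surjective a.left] (b : T ⟶ X)
    {c : complexBetti Z (2 * p)} {c' : complexBetti X (2 * p)}
    (hc' : c' ∈ Submodule.span ℂ
      {x : complexBetti X (2 * p) | IsRationalClass x ∧ IsOfHodgeType k X (2 * p) p p x})
    (hab : complexBetti.map a (2 * p) c = complexBetti.map b (2 * p) c') :
    c ∈ algebraicClasses Z p := by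
  -- Shioda: every rational `(p,p)`-class of the Fermat variety is algebraic, hence so is their `ℂ`-span
  have hX' : c' ∈ algebraicClasses X p :=
    (Submodule.span_le.2 fun x hx ↦ hF hm hXF hX p x hx.1 hx.2) hc'
  -- Fulton: the pull-back `b^* c'` is algebraic on `T`
  have hT' : complexBetti.map b (2 * p) c' ∈ algebraicClasses T p := hP b hX hT p c' hX'
  -- degree trick along the surjective equidimensional `a`
  rw [← hab] at hT'
  exact mem_algebraicClasses_of_map_mem_of_surjective hT hZ a hT'

/-- **Subspace form of the principle**: a subspace `S ⊆ H²ᵖ(Z(ℂ); ℂ)` every class of which has a Fermat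
partner (`a^* c = b^* c'`, `c'` in the span of the rational `(p,p)`-classes of `Xᵏₘ`) consists of algebraic
classes. [cite: Shioda1979PJA, §2 Thm. 1 and the list after it (p. 112)] [cite: Fulton1998, §19.2 Cor. 19.2 (b)] -/
theorem le_algebraicClasses_of_fermatTransfer
    (hF : hodgeClasses_algebraic_fermat) (hP : fulton1998_map_mem_algebraicClasses)
    (hm : m.Prime ∨ (1 < m ∧ m ≤ 20)) (hXF : IsFermatVariety k m X) (hX : IsSmoothProjective k X)
    (hZ : IsSmoothProjective z Z) (hT : IsSmoothProjective z T)
    (a : T ⟶ Z) [AlgebraicGeometry.Surjective a.left] (b : T ⟶ X)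
    {S : Submodule ℂ (complexBetti Z (2 * p))}
    (h : ∀ c ∈ S, ∃ c' ∈ Submodule.span ℂ
        {x : complexBetti X (2 * p) | IsRationalClass x ∧ IsOfHodgeType k X (2 * p) p p x},
        complexBetti.map a (2 * p) c = complexBetti.map b (2 * p) c') :
    S ≤ algebraicClasses Z p := by
  intro c hc
  obtain ⟨c', hc', hab⟩ := h c hc
  exact mem_algebraicClasses_of_fermatTransfer hF hP hm hXF hX hZ hT a b hc' hab

/-- **The principle on an abelian variety** (`Z = A`, smooth projective of dimension `dim A` by the tree's
`AbelianVariety.isSmoothProjective_holds`): a class of `H²ᵖ(A(ℂ))` with a Fermat partner along a surjective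
`a : T ⟶ A`, `dim T = dim A`, is algebraic. This is the transfer of THEOREM F (packet), `A = B` the primitive
Prym, `T` a resolution of the dominant component of `Cʰ ×_{Cʰ/G} Xʰ₆`.
[cite: Shioda1979PJA, §2 Thm. 1 and the list after it (p. 112)] [cite: Fulton1998, §19.2 Cor. 19.2 (b)]
[cite: Schoen1988HodgeWeil, §3 Cor. 3.1 (proof, pp. 24–25)] -/
theorem abelianVariety_mem_algebraicClasses_of_fermatTransfer
    (hF : hodgeClasses_algebraic_fermat) (hP : fulton1998_map_mem_algebraicClasses)
    (A : Motives.AbelianVariety ℂ)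
    (hm : m.Prime ∨ (1 < m ∧ m ≤ 20)) (hXF : IsFermatVariety k m X) (hX : IsSmoothProjective k X)
    (hT : IsSmoothProjective A.dim T) (a : T ⟶ A.X) [AlgebraicGeometry.Surjective a.left] (b : T ⟶ X)
    {c : complexBetti A.X (2 * p)} {c' : complexBetti X (2 * p)}
    (hc' : c' ∈ Submodule.span ℂ
      {x : complexBetti X (2 * p) | IsRationalClass x ∧ IsOfHodgeType k X (2 * p) p p x})
    (hab : complexBetti.map a (2 * p) c = complexBetti.map b (2 * p) c') :
    c ∈ algebraicClasses A.X p :=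
  mem_algebraicClasses_of_fermatTransfer hF hP hm hXF hX
    (Motives.AbelianVariety.isSmoothProjective_holds : IsSmoothProjective A.dim A.X) hT a b hc' hab

end Principle

/-! ### §2 R∞-shaped body on the Fermat-dominated locus (every `n ≥ 2`, every `d`, every Fermat `Xᵏₘ`) -/

section Rinfty

/-- **R∞ on the Fermat-dominated locus, from the two facts.** The body of `WeilClassesImaginaryQuadratic`
(rung binders first and verbatim), then a FERMAT TRANSFER DATUM `(m, k, X = Xᵏₘ, T, a, b)` with `dim T = 2n`,
`a : T ⟶ A` surjective, then the conclusion for every class `c` of the Weil plane having a Fermat partner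
`c'` (`a^* c = b^* c'`, `c'` in the span of the rational `(n,n)`-classes of `X`). The rationality / Hodge
type hypotheses on `c` and `φ ≫ φ = -d` are carried, not used: the partner does everything.
[cite: Shioda1979PJA, §2 Thm. 1 and the list after it (p. 112)] [cite: Fulton1998, §19.2 Cor. 19.2 (b)] -/
theorem weilClassesImaginaryQuadratic_fermatTransfer_of_facts
    (hF : hodgeClasses_algebraic_fermat) (hP : fulton1998_map_mem_algebraicClasses) :
    ∀ (n : ℕ), 2 ≤ n → ∀ (d : ℕ), 0 < d → ∀ (A : Motives.AbelianVariety ℂ) (φ : A ⟶ A), A.dim = 2 * n →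
      Motives.IsSmoothProjective (2 * n) A.X → φ ≫ φ = -(d • 𝟙 A) →
    ∀ (m k : ℕ), m.Prime ∨ (1 < m ∧ m ≤ 20) → ∀ (X T : Motives.SchemeOver ℂ),
      IsFermatVariety k m X → IsSmoothProjective k X → IsSmoothProjective (2 * n) T →
    ∀ (a : T ⟶ A.X) (b : T ⟶ X), AlgebraicGeometry.Surjective a.left →
      ∀ c : complexBetti A.X (2 * n),
        (∃ c' ∈ Submodule.span ℂ
            {x : complexBetti X (2 * n) | IsRationalClass x ∧ IsOfHodgeType k X (2 * n) n n x},
          complexBetti.map a (2 * n) c = complexBetti.map b (2 * n) c') →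
        IsRationalClass c → IsOfHodgeType (2 * n) A.X (2 * n) n n c →
        c ∈ weilClassesOf A φ n d → c ∈ algebraicClasses A.X n := by
  intro n _ d _ A φ _ hA _ m k hm X T hXF hX hT a b ha c hc _ _ _
  obtain ⟨c', hc', hab⟩ := hc
  exact mem_algebraicClasses_of_fermatTransfer hF hP hm hXF hX hA hT a b hc' hab

/-- **The same body from the rung R∞ itself** (`WeilClassesImaginaryQuadratic`; the transfer datum is
not used): the Fermat-dominated locus is a CASE of the rung. -/
theorem weilClassesImaginaryQuadratic_fermatTransfer_of_weilClassesImaginaryQuadratic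
    (h : WeilClassesImaginaryQuadratic) :
    ∀ (n : ℕ), 2 ≤ n → ∀ (d : ℕ), 0 < d → ∀ (A : Motives.AbelianVariety ℂ) (φ : A ⟶ A), A.dim = 2 * n →
      Motives.IsSmoothProjective (2 * n) A.X → φ ≫ φ = -(d • 𝟙 A) →
    ∀ (m k : ℕ), m.Prime ∨ (1 < m ∧ m ≤ 20) → ∀ (X T : Motives.SchemeOver ℂ),
      IsFermatVariety k m X → IsSmoothProjective k X → IsSmoothProjective (2 * n) T →
    ∀ (a : T ⟶ A.X) (b : T ⟶ X), AlgebraicGeometry.Surjective a.left →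
      ∀ c : complexBetti A.X (2 * n),
        (∃ c' ∈ Submodule.span ℂ
            {x : complexBetti X (2 * n) | IsRationalClass x ∧ IsOfHodgeType k X (2 * n) n n x},
          complexBetti.map a (2 * n) c = complexBetti.map b (2 * n) c') →
        IsRationalClass c → IsOfHodgeType (2 * n) A.X (2 * n) n n c →
        c ∈ weilClassesOf A φ n d → c ∈ algebraicClasses A.X n := by
  intro n hn d hd A φ hdim hA hφ _ _ _ _ _ _ _ _ _ _ _ c _ hc hnn hW
  exact h n hn d hd A φ hdim hA hφ c hc hnn hW

/-- **On-path lemma**: the Hodge conjecture implies R∞ on the Fermat-dominated locus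
(`HodgeConjecture → WeilClassesImaginaryQuadratic →` the locus). -/
theorem weilClassesImaginaryQuadratic_fermatTransfer_of_hodgeConjecture (h : _root_.HodgeConjecture) :
    ∀ (n : ℕ), 2 ≤ n → ∀ (d : ℕ), 0 < d → ∀ (A : Motives.AbelianVariety ℂ) (φ : A ⟶ A), A.dim = 2 * n →
      Motives.IsSmoothProjective (2 * n) A.X → φ ≫ φ = -(d • 𝟙 A) →
    ∀ (m k : ℕ), m.Prime ∨ (1 < m ∧ m ≤ 20) → ∀ (X T : Motives.SchemeOver ℂ),
      IsFermatVariety k m X → IsSmoothProjective k X → IsSmoothProjective (2 * n) T →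
    ∀ (a : T ⟶ A.X) (b : T ⟶ X), AlgebraicGeometry.Surjective a.left →
      ∀ c : complexBetti A.X (2 * n),
        (∃ c' ∈ Submodule.span ℂ
            {x : complexBetti X (2 * n) | IsRationalClass x ∧ IsOfHodgeType k X (2 * n) n n x},
          complexBetti.map a (2 * n) c = complexBetti.map b (2 * n) c') →
        IsRationalClass c → IsOfHodgeType (2 * n) A.X (2 * n) n n c →
        c ∈ weilClassesOf A φ n d → c ∈ algebraicClasses A.X n :=
  weilClassesImaginaryQuadratic_fermatTransfer_of_weilClassesImaginaryQuadratic
    (weilClassesImaginaryQuadratic_of_hodgeConjecture h)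

end Rinfty

/-! ### §3 CL4-candidate: R1′ (`NonsplitSixfolds`, `d = 3`) on the sixfolds dominated by the Fermat sextic sixfold `X⁶₆` -/

section Sixfolds

/-- **R1′ at `d = 3` on the Fermat-sextic-dominated sixfolds, from the two facts.** The literal body of
`NonsplitSixfolds` at `d = 3` (`K = ℚ(√-3)`; rung binders first and verbatim, INCLUDING the
non-hyperbolicity binder "no `K`-symmetrised hyperplane class is hyperbolic" — carried, not used), then a
Fermat transfer datum `(X = X⁶₆, T, a, b)` — `X` the smooth projective Fermat SEXTIC SIXFOLD
`x₀⁶ + ⋯ + x₇⁶ = 0 ⊂ ℙ⁷`, `T` smooth projective of dimension `6`, `a : T ⟶ A` surjective, `b : T ⟶ X` — and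
the conclusion for every class of the Weil plane `weilClassesOf A φ 3 3` with a Fermat partner. By the
packet's THEOREM F (pen-and-paper) every member of the 31 Weil-type `ℤ/6`-Prym families over `ℙ¹` with 8
branch points carries such a datum with a partner for EVERY Weil class — among them the twelve NON-SPLIT
families of CENSUS C15 (`cyclicSextic_nonsimpleWeil_octuples_odd_three`). Conditional on [Shioda 1979]
(`(P⁶₆)`: "m ≤ 20, all n") and [Fulton 1998, Cor. 19.2 (b)] only.
[cite: Shioda1979PJA, §2 Thm. 1 and the list after it (p. 112)] [cite: Fulton1998, §19.2 Cor. 19.2 (b)]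
[cite: Schoen1988HodgeWeil, §1 Lemma 1.1, Cor. 1.9 and §3 Cor. 3.1 (proof, pp. 24–25)] -/
theorem nonsplitSixfolds_fermatSexticTransfer_of_facts
    (hF : hodgeClasses_algebraic_fermat) (hP : fulton1998_map_mem_algebraicClasses) :
    ∀ (A : Motives.AbelianVariety ℂ) (φ : A ⟶ A), A.dim = 2 * 3 →
      Motives.IsSmoothProjective (2 * 3) A.X → φ ≫ φ = -((3 : ℕ) • 𝟙 A) →
      (∀ (e : Motives.ProjectiveEmbedding A.X) (a : complexBetti (Motives.projectiveSpace e.n ℂ) 2),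
        IsRationalClass a → a ≠ 0 →
          ¬ Motives.IsHyperbolicWeilType A φ 3
            (((3 : ℕ) : ℂ) • complexBetti.map e.ι 2 a +
              complexBetti.map φ.hom.hom.hom 2 (complexBetti.map e.ι 2 a))) →
    ∀ (X T : Motives.SchemeOver ℂ),
      IsFermatVariety 6 6 X → IsSmoothProjective 6 X → IsSmoothProjective (2 * 3) T →
    ∀ (a : T ⟶ A.X) (b : T ⟶ X), AlgebraicGeometry.Surjective a.left →
      ∀ c : complexBetti A.X (2 * 3),
        (∃ c' ∈ Submodule.span ℂ
            {x : complexBetti X (2 * 3) | IsRationalClass x ∧ IsOfHodgeType 6 X (2 * 3) 3 3 x},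
          complexBetti.map a (2 * 3) c = complexBetti.map b (2 * 3) c') →
        IsRationalClass c → IsOfHodgeType (2 * 3) A.X (2 * 3) 3 3 c →
        c ∈ weilClassesOf A φ 3 3 → c ∈ algebraicClasses A.X 3 := by
  intro A φ _ hA _ _ X T hXF hX hT a b ha c hc _ _ _
  obtain ⟨c', hc', hab⟩ := hc
  exact mem_algebraicClasses_of_fermatTransfer hF hP (m := 6) (Or.inr ⟨by norm_num, by norm_num⟩) hXF hX
    hA hT a b hc' hab

/-- **The same body from the rung R1′ itself** (`NonsplitSixfolds` at `d = 3`; the transfer datum is not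
used): the Fermat-sextic-dominated non-split sixfolds are a CASE of the rung. -/
theorem nonsplitSixfolds_fermatSexticTransfer_of_nonsplitSixfolds (h : NonsplitSixfolds) :
    ∀ (A : Motives.AbelianVariety ℂ) (φ : A ⟶ A), A.dim = 2 * 3 →
      Motives.IsSmoothProjective (2 * 3) A.X → φ ≫ φ = -((3 : ℕ) • 𝟙 A) →
      (∀ (e : Motives.ProjectiveEmbedding A.X) (a : complexBetti (Motives.projectiveSpace e.n ℂ) 2),
        IsRationalClass a → a ≠ 0 →
          ¬ Motives.IsHyperbolicWeilType A φ 3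
            (((3 : ℕ) : ℂ) • complexBetti.map e.ι 2 a +
              complexBetti.map φ.hom.hom.hom 2 (complexBetti.map e.ι 2 a))) →
    ∀ (X T : Motives.SchemeOver ℂ),
      IsFermatVariety 6 6 X → IsSmoothProjective 6 X → IsSmoothProjective (2 * 3) T →
    ∀ (a : T ⟶ A.X) (b : T ⟶ X), AlgebraicGeometry.Surjective a.left →
      ∀ c : complexBetti A.X (2 * 3),
        (∃ c' ∈ Submodule.span ℂ
            {x : complexBetti X (2 * 3) | IsRationalClass x ∧ IsOfHodgeType 6 X (2 * 3) 3 3 x},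
          complexBetti.map a (2 * 3) c = complexBetti.map b (2 * 3) c') →
        IsRationalClass c → IsOfHodgeType (2 * 3) A.X (2 * 3) 3 3 c →
        c ∈ weilClassesOf A φ 3 3 → c ∈ algebraicClasses A.X 3 := by
  intro A φ hdim hA hφ hnh _ _ _ _ _ _ _ _ c _ hc h33 hW
  exact h 3 (by norm_num) A φ hdim hA hφ hnh c hc h33 hW

/-- **On-path lemma (CL4-candidate)**: the Hodge conjecture implies R1′ on the Fermat-sextic-dominated
non-split ℚ(√-3)-sixfolds (`HodgeConjecture → NonsplitSixfolds →` the locus). -/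
theorem nonsplitSixfolds_fermatSexticTransfer_of_hodgeConjecture (h : _root_.HodgeConjecture) :
    ∀ (A : Motives.AbelianVariety ℂ) (φ : A ⟶ A), A.dim = 2 * 3 →
      Motives.IsSmoothProjective (2 * 3) A.X → φ ≫ φ = -((3 : ℕ) • 𝟙 A) →
      (∀ (e : Motives.ProjectiveEmbedding A.X) (a : complexBetti (Motives.projectiveSpace e.n ℂ) 2),
        IsRationalClass a → a ≠ 0 →
          ¬ Motives.IsHyperbolicWeilType A φ 3
            (((3 : ℕ) : ℂ) • complexBetti.map e.ι 2 a +
              complexBetti.map φ.hom.hom.hom 2 (complexBetti.map e.ι 2 a))) →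
    ∀ (X T : Motives.SchemeOver ℂ),
      IsFermatVariety 6 6 X → IsSmoothProjective 6 X → IsSmoothProjective (2 * 3) T →
    ∀ (a : T ⟶ A.X) (b : T ⟶ X), AlgebraicGeometry.Surjective a.left →
      ∀ c : complexBetti A.X (2 * 3),
        (∃ c' ∈ Submodule.span ℂ
            {x : complexBetti X (2 * 3) | IsRationalClass x ∧ IsOfHodgeType 6 X (2 * 3) 3 3 x},
          complexBetti.map a (2 * 3) c = complexBetti.map b (2 * 3) c') →
        IsRationalClass c → IsOfHodgeType (2 * 3) A.X (2 * 3) 3 3 c →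
        c ∈ weilClassesOf A φ 3 3 → c ∈ algebraicClasses A.X 3 :=
  nonsplitSixfolds_fermatSexticTransfer_of_nonsplitSixfolds (nonsplitSixfolds_of_hodgeConjecture h)

/-- **The Weil PLANE of a Fermat-sextic-dominated sixfold is algebraic** (subspace form, no rationality /
Hodge-type / polarization hypothesis: what THEOREM F delivers for the primitive Prym `B` of a Weil-type
`ℤ/6`-cover of `ℙ¹` with 8 branch points, whose every Weil class has a Fermat partner).
[cite: Shioda1979PJA, §2 Thm. 1 and the list after it (p. 112)] [cite: Fulton1998, §19.2 Cor. 19.2 (b)] -/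
theorem weilClassesOf_sixfold_le_algebraicClasses_of_fermatSexticTransfer
    (hF : hodgeClasses_algebraic_fermat) (hP : fulton1998_map_mem_algebraicClasses)
    {B : Motives.AbelianVariety ℂ} {ψ₀ : B ⟶ B} {d : ℕ} (hdim : B.dim = 2 * 3)
    {X T : Motives.SchemeOver ℂ} (hXF : IsFermatVariety 6 6 X) (hX : IsSmoothProjective 6 X)
    (hT : IsSmoothProjective (2 * 3) T) (a : T ⟶ B.X) [AlgebraicGeometry.Surjective a.left] (b : T ⟶ X)
    (h : ∀ c ∈ weilClassesOf B ψ₀ 3 d, ∃ c' ∈ Submodule.span ℂ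
        {x : complexBetti X (2 * 3) | IsRationalClass x ∧ IsOfHodgeType 6 X (2 * 3) 3 3 x},
        complexBetti.map a (2 * 3) c = complexBetti.map b (2 * 3) c') :
    weilClassesOf B ψ₀ 3 d ≤ algebraicClasses B.X 3 := by
  have hB : IsSmoothProjective (2 * 3) B.X := by
    rw [← hdim]
    exact Motives.AbelianVariety.isSmoothProjective_holds
  exact le_algebraicClasses_of_fermatTransfer hF hP (m := 6) (Or.inr ⟨by norm_num, by norm_num⟩) hXF hX
    hB hT a b h

end Sixfolds

/-! ### §4 R2₈ (`SplitEightfolds`, `d = 3`) on the eightfolds dominated by the Fermat sextic eightfold `X⁸₆` -/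

section Eightfolds

/-- **R2₈ at `d = 3` on the Fermat-sextic-dominated eightfolds, from the two facts.** The literal body of
`SplitEightfolds` at `d = 3` (rung binders first and verbatim, the hyperbolicity binder carried unused),
then a Fermat transfer datum `(X = X⁸₆, T, a, b)` with the smooth projective Fermat SEXTIC EIGHTFOLD
`x₀⁶ + ⋯ + x₉⁶ = 0 ⊂ ℙ⁹`, then the conclusion for the Weil classes with a Fermat partner. By THEOREM F the
53 Weil-type `ℤ/6`-Prym families over `ℙ¹` with 10 branch points carry such data (31 split, 22 non-split;
`cyclicSextic_nonsimpleWeil_decuples_card`). Conditional on [Shioda 1979] (`(P⁸₆)`) and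
[Fulton 1998, Cor. 19.2 (b)] only. [cite: Shioda1979PJA, §2 Thm. 1 and the list after it (p. 112)]
[cite: Fulton1998, §19.2 Cor. 19.2 (b)] -/
theorem splitEightfolds_fermatSexticTransfer_of_facts
    (hF : hodgeClasses_algebraic_fermat) (hP : fulton1998_map_mem_algebraicClasses) :
    ∀ (A : Motives.AbelianVariety ℂ) (φ : A ⟶ A), A.dim = 2 * 4 →
      Motives.IsSmoothProjective (2 * 4) A.X → φ ≫ φ = -((3 : ℕ) • 𝟙 A) →
      ∀ (e : Motives.ProjectiveEmbedding A.X)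
        (a : complexBetti (Motives.projectiveSpace e.n ℂ) 2), IsRationalClass a → a ≠ 0 →
        Motives.IsHyperbolicWeilType A φ 4
          (((3 : ℕ) : ℂ) • complexBetti.map e.ι 2 a +
            complexBetti.map φ.hom.hom.hom 2 (complexBetti.map e.ι 2 a)) →
    ∀ (X T : Motives.SchemeOver ℂ),
      IsFermatVariety 8 6 X → IsSmoothProjective 8 X → IsSmoothProjective (2 * 4) T →
    ∀ (a : T ⟶ A.X) (b : T ⟶ X), AlgebraicGeometry.Surjective a.left →
      ∀ c : complexBetti A.X (2 * 4),
        (∃ c' ∈ Submodule.span ℂ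
            {x : complexBetti X (2 * 4) | IsRationalClass x ∧ IsOfHodgeType 8 X (2 * 4) 4 4 x},
          complexBetti.map a (2 * 4) c = complexBetti.map b (2 * 4) c') →
        IsRationalClass c → IsOfHodgeType (2 * 4) A.X (2 * 4) 4 4 c →
        c ∈ weilClassesOf A φ 4 3 → c ∈ algebraicClasses A.X 4 := by
  intro A φ _ hA _ _ _ _ _ _ X T hXF hX hT a b ha c hc _ _ _
  obtain ⟨c', hc', hab⟩ := hc
  exact mem_algebraicClasses_of_fermatTransfer hF hP (m := 6) (Or.inr ⟨by norm_num, by norm_num⟩) hXF hX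
    hA hT a b hc' hab

/-- **The same body from the rung R2₈ itself** (`SplitEightfolds` at `d = 3`; the transfer datum is not
used). -/
theorem splitEightfolds_fermatSexticTransfer_of_splitEightfolds (h : SplitEightfolds) :
    ∀ (A : Motives.AbelianVariety ℂ) (φ : A ⟶ A), A.dim = 2 * 4 →
      Motives.IsSmoothProjective (2 * 4) A.X → φ ≫ φ = -((3 : ℕ) • 𝟙 A) →
      ∀ (e : Motives.ProjectiveEmbedding A.X)
        (a : complexBetti (Motives.projectiveSpace e.n ℂ) 2), IsRationalClass a → a ≠ 0 →
        Motives.IsHyperbolicWeilType A φ 4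
          (((3 : ℕ) : ℂ) • complexBetti.map e.ι 2 a +
            complexBetti.map φ.hom.hom.hom 2 (complexBetti.map e.ι 2 a)) →
    ∀ (X T : Motives.SchemeOver ℂ),
      IsFermatVariety 8 6 X → IsSmoothProjective 8 X → IsSmoothProjective (2 * 4) T →
    ∀ (a : T ⟶ A.X) (b : T ⟶ X), AlgebraicGeometry.Surjective a.left →
      ∀ c : complexBetti A.X (2 * 4),
        (∃ c' ∈ Submodule.span ℂ
            {x : complexBetti X (2 * 4) | IsRationalClass x ∧ IsOfHodgeType 8 X (2 * 4) 4 4 x},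
          complexBetti.map a (2 * 4) c = complexBetti.map b (2 * 4) c') →
        IsRationalClass c → IsOfHodgeType (2 * 4) A.X (2 * 4) 4 4 c →
        c ∈ weilClassesOf A φ 4 3 → c ∈ algebraicClasses A.X 4 := by
  intro A φ hdim hA hφ e a' ha' ha0 hh _ _ _ _ _ _ _ _ c _ hc h44 hW
  exact h 3 (by norm_num) A φ hdim hA hφ e a' ha' ha0 hh c hc h44 hW

/-- **On-path lemma**: the Hodge conjecture implies R2₈ on the Fermat-sextic-dominated eightfolds
(`HodgeConjecture → SplitEightfolds →` the locus). -/
theorem splitEightfolds_fermatSexticTransfer_of_hodgeConjecture (h : _root_.HodgeConjecture) :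
    ∀ (A : Motives.AbelianVariety ℂ) (φ : A ⟶ A), A.dim = 2 * 4 →
      Motives.IsSmoothProjective (2 * 4) A.X → φ ≫ φ = -((3 : ℕ) • 𝟙 A) →
      ∀ (e : Motives.ProjectiveEmbedding A.X)
        (a : complexBetti (Motives.projectiveSpace e.n ℂ) 2), IsRationalClass a → a ≠ 0 →
        Motives.IsHyperbolicWeilType A φ 4
          (((3 : ℕ) : ℂ) • complexBetti.map e.ι 2 a +
            complexBetti.map φ.hom.hom.hom 2 (complexBetti.map e.ι 2 a)) →
    ∀ (X T : Motives.SchemeOver ℂ),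
      IsFermatVariety 8 6 X → IsSmoothProjective 8 X → IsSmoothProjective (2 * 4) T →
    ∀ (a : T ⟶ A.X) (b : T ⟶ X), AlgebraicGeometry.Surjective a.left →
      ∀ c : complexBetti A.X (2 * 4),
        (∃ c' ∈ Submodule.span ℂ
            {x : complexBetti X (2 * 4) | IsRationalClass x ∧ IsOfHodgeType 8 X (2 * 4) 4 4 x},
          complexBetti.map a (2 * 4) c = complexBetti.map b (2 * 4) c') →
        IsRationalClass c → IsOfHodgeType (2 * 4) A.X (2 * 4) 4 4 c →
        c ∈ weilClassesOf A φ 4 3 → c ∈ algebraicClasses A.X 4 :=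
  splitEightfolds_fermatSexticTransfer_of_splitEightfolds (splitEightfolds_of_hodgeConjecture h)

end Eightfolds

end Summit.HodgeConjecture.HodgeConjecture.WeilTypeLadder

end
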